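import Mathlib
import HarnessLib
import Summits.HubbardSuperconductivity.HubbardSuperconductivity.Theorems.BalabanIRBirGappedPhaseReductionTraceHolder
import Literature.Probability.LatticeModels.LatticeGraph

/-!
# Sketch — crux-ideate `stmt-HubbardSuperconductivity-1268` (`NodalWardXY.NodalReduction`), ideator 1, round 1

First lemmas of the idea cards (statements must elaborate; proofs may be `sorry`):

* card `schur-split-anneal`:
  `mwt` / `matsubaraCov` (spectral form of the bosonic-frequency Matsubara covariance of two
  observables in a Gibbs state), `re_matsubaraGram_nonneg` (ACCRETIVITY: positive Hermitian
  part, frequency by frequency — the finite-dimensional Osterwalder–Schrader shadow the lever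
  rests on), `matsubaraCov_swap` (KMS/cyclicity pairing `ω ↔ -ω`), and the real Schur split
  `schurSplit_quadratic` / `posSemidef_schurShiftForm` (damping form minus an unloadable PSD
  spatial form). PROVED here (no sorry): `mwt_re_nonneg`, `matsubaraGram_eq` (Gram expansion),
  `re_matsubaraGram_nonneg` (the ACCRETIVITY first lemma itself), `schurSplit_quadratic`,
  `posSemidef_schurShiftForm`; only `mwt_swap_eq_conj`, `matsubaraCov_swap`,
  `matsubaraCov_self_nonneg` remain `sorry` (secondary).
* card `holder-static-visons`:
  `plaquetteWinding`, `vortexCount`, the typed static input `NodalTextureCoercivityModVortices`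
  (pure `d_{x²-y²}`, i.e. the `Δ₂ = 0` nodal analogue of `BalabanIR.BirBdGPhaseCoercivity`
  weakened by a vortex allowance), and the composition shape with the tree's dyadic trace Hölder
  dictionary `norm_trace_prod_exp_le_exp_sub_sum`.
-/

noncomputable section

open scoped BigOperators ComplexConjugate ComplexOrder Matrix
open Matrix Finset

namespace Summit.HubbardSuperconductivity.HubbardSuperconductivity.Cruxes.NodalReduction.SketchIdeator1

/-! ## Card `schur-split-anneal` -/

section Matsubara

variable {n : Type*} [Fintype n] [DecidableEq n]

/-- Complex Matsubara pair weight at bosonic frequency `ω ≠ 0`: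
`w_β(ω; E_m, E_n) = (e^{-βE_m} - e^{-βE_n}) (E_n - E_m + iω) / ((E_n - E_m)² + ω²)`
`= ∫₀^β e^{iωτ} e^{-βE_m} e^{τ(E_m - E_n)} dτ` (using `e^{iωβ} = 1`). Its real part
`(e^{-βE_m} - e^{-βE_n})(E_n - E_m)/(…) ≥ 0`; its imaginary part is odd under `m ↔ n`. -/
def mwt (β ω Em En : ℝ) : ℂ :=
  ((Real.exp (-β * Em) - Real.exp (-β * En) : ℝ) : ℂ) *
    ((((En - Em : ℝ)) : ℂ) + Complex.I * (ω : ℂ)) / (((En - Em) ^ 2 + ω ^ 2 : ℝ) : ℂ)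

theorem mwt_re_nonneg {β : ℝ} (hβ : 0 ≤ β) (ω Em En : ℝ) : 0 ≤ (mwt β ω Em En).re := by
  unfold mwt
  have hden : 0 ≤ (En - Em) ^ 2 + ω ^ 2 := by positivity
  -- (e^{-βEm} - e^{-βEn}) and (En - Em) have the same sign
  have hsame : 0 ≤ (Real.exp (-β * Em) - Real.exp (-β * En)) * (En - Em) := by
    rcases le_total Em En with h | h
    · have : Real.exp (-β * En) ≤ Real.exp (-β * Em) :=
        Real.exp_le_exp.mpr (by nlinarith)
      exact mul_nonneg (by linarith) (by linarith)
    · have : Real.exp (-β * Em) ≤ Real.exp (-β * En) :=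
        Real.exp_le_exp.mpr (by nlinarith)
      exact mul_nonneg_of_nonpos_of_nonpos (by linarith) (by linarith)
  have hz : ((((Real.exp (-β * Em) - Real.exp (-β * En) : ℝ)) : ℂ) *
      ((((En - Em : ℝ)) : ℂ) + Complex.I * (ω : ℂ))).re =
        (Real.exp (-β * Em) - Real.exp (-β * En)) * (En - Em) := by
    simp only [Complex.mul_re, Complex.add_re, Complex.ofReal_re, Complex.ofReal_im,
      Complex.mul_im, Complex.I_re, Complex.I_im, Complex.add_im, zero_mul, one_mul, mul_zero,
      sub_zero, zero_add, add_zero]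
  rw [Complex.div_ofReal_re, hz]
  exact div_nonneg hsame hden

theorem mwt_swap_eq_conj (β ω Em En : ℝ) : mwt β ω En Em = conj (mwt β ω Em En) := by
  sorry

/-- Spectral form of the (un-normalised) Matsubara covariance
`Ĉ_{AB}(ω) = ∫₀^β e^{iωτ} Tr(e^{-(β-τ)H} A e^{-τH} B) dτ = Σ_{m,n} w(ω;E_m,E_n) A_{mn} B_{nm}`
(matrix elements in the eigenbasis of `H`). -/
def matsubaraCov {H : Matrix n n ℂ} (hH : H.IsHermitian) (β ω : ℝ) (A B : Matrix n n ℂ) : ℂ :=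
  ∑ i, ∑ j, mwt β ω (hH.eigenvalues i) (hH.eigenvalues j) *
    ((hH.eigenvectorUnitary : Matrix n n ℂ)ᴴ * A * (hH.eigenvectorUnitary : Matrix n n ℂ)) i j *
    ((hH.eigenvectorUnitary : Matrix n n ℂ)ᴴ * B * (hH.eigenvectorUnitary : Matrix n n ℂ)) j i

/-- Gram expansion: the quadratic form of the Matsubara covariance over a family. -/
theorem matsubaraGram_eq {r : Type*} [Fintype r] {H : Matrix n n ℂ} (hH : H.IsHermitian)
    (β ω : ℝ) (A : r → Matrix n n ℂ) (hA : ∀ a, (A a).IsHermitian) (c : r → ℂ) :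
    (∑ a, ∑ b, conj (c a) * matsubaraCov hH β ω (A a) (A b) * c b) =
      ∑ i, ∑ j, mwt β ω (hH.eigenvalues i) (hH.eigenvalues j) *
        ((∑ a, star (c a) • ((hH.eigenvectorUnitary : Matrix n n ℂ)ᴴ * A a *
            (hH.eigenvectorUnitary : Matrix n n ℂ))) i j *
         star ((∑ a, star (c a) • ((hH.eigenvectorUnitary : Matrix n n ℂ)ᴴ * A a *
            (hH.eigenvectorUnitary : Matrix n n ℂ))) i j)) := by
  set U : Matrix n n ℂ := (hH.eigenvectorUnitary : Matrix n n ℂ) with hU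
  have hXh : ∀ a, (Uᴴ * A a * U).IsHermitian :=
    fun a => Matrix.isHermitian_conjTranspose_mul_mul U (hA a)
  set Z : Matrix n n ℂ := ∑ a, star (c a) • (Uᴴ * A a * U) with hZ
  have hZH : Zᴴ = ∑ b, c b • (Uᴴ * A b * U) := by
    rw [hZ, Matrix.conjTranspose_sum]
    refine Finset.sum_congr rfl fun b _ => ?_
    rw [Matrix.conjTranspose_smul, star_star, (hXh b).eq]
  have hZij : ∀ i j, Z i j = ∑ a, star (c a) * (Uᴴ * A a * U) i j := by
    intro i j
    rw [hZ, Matrix.sum_apply]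
    simp only [Matrix.smul_apply, smul_eq_mul]
  have hYji : ∀ i j, star (Z i j) = ∑ b, c b * (Uᴴ * A b * U) j i := by
    intro i j
    have h1 : star (Z i j) = Zᴴ j i := (Matrix.conjTranspose_apply Z i j).symm
    rw [h1, hZH, Matrix.sum_apply]
    simp only [Matrix.smul_apply, smul_eq_mul]
  -- rewrite the right-hand side entries: Z i j * star (Z i j) with the two explicit sums
  have hrhs : ∀ i j, Z i j * star (Z i j) =
      (∑ a, star (c a) * (Uᴴ * A a * U) i j) * (∑ b, c b * (Uᴴ * A b * U) j i) := by
    intro i j; rw [hYji, hZij]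
  simp_rw [hrhs]
  have swap4 : ∀ (T : r → r → n → n → ℂ),
      (∑ a, ∑ b, ∑ i, ∑ j, T a b i j) = ∑ i, ∑ j, ∑ a, ∑ b, T a b i j := by
    intro T
    calc (∑ a, ∑ b, ∑ i, ∑ j, T a b i j) = ∑ a, ∑ i, ∑ b, ∑ j, T a b i j := by
          refine Finset.sum_congr rfl fun a _ => ?_; rw [Finset.sum_comm]
      _ = ∑ i, ∑ a, ∑ b, ∑ j, T a b i j := Finset.sum_comm
      _ = ∑ i, ∑ a, ∑ j, ∑ b, T a b i j := by
          refine Finset.sum_congr rfl fun i _ => Finset.sum_congr rfl fun a _ => ?_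
          rw [Finset.sum_comm]
      _ = ∑ i, ∑ j, ∑ a, ∑ b, T a b i j := by
          refine Finset.sum_congr rfl fun i _ => ?_; rw [Finset.sum_comm]
  -- expand both sides into quadruple sums
  simp only [matsubaraCov, Finset.mul_sum, Finset.sum_mul]
  rw [← hU]
  have h4 := swap4 (fun a b i j => (starRingEnd ℂ) (c a) *
      (mwt β ω (hH.eigenvalues i) (hH.eigenvalues j) * (Uᴴ * A a * U) i j * (Uᴴ * A b * U) j i) *
        c b)
  rw [h4]
  refine Finset.sum_congr rfl fun i _ => Finset.sum_congr rfl fun j _ => ?_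
  rw [Finset.sum_comm]
  refine Finset.sum_congr rfl fun b _ => Finset.sum_congr rfl fun a _ => ?_
  simp only [starRingEnd_apply]
  ring

/-- **ACCRETIVITY (first lemma of `schur-split-anneal`).** For Hermitian `H`, Hermitian
observables `A : r → Mat`, `β ≥ 0` and any bosonic frequency `ω`, the Matsubara Gram form has
non-negative real part: `0 ≤ Re Σ_{a,b} conj(c_a) Ĉ_{A_a A_b}(ω) c_b` for every `c : r → ℂ`
(equivalently `(Ĉ + Ĉᴴ)/2 ⪰ 0`). Proof: `= Σ_{m,n} w_{mn} |Σ_b c_b conj((U†A_bU)_{mn})|²` with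
`Re w_{mn} ≥ 0` (`mwt_re_nonneg`). Note `Ĉ(ω)` itself is NOT Hermitian for `ω ≠ 0`
(two-level example `A = σ_x, σ_y`: `Ĉ = (2/(ε²+ω²)) [[ε,-ω],[ω,ε]]`). -/
theorem re_matsubaraGram_nonneg {r : Type*} [Fintype r] {H : Matrix n n ℂ} (hH : H.IsHermitian)
    {β : ℝ} (hβ : 0 ≤ β) (ω : ℝ) (A : r → Matrix n n ℂ) (hA : ∀ a, (A a).IsHermitian)
    (c : r → ℂ) :
    0 ≤ (∑ a, ∑ b, conj (c a) * matsubaraCov hH β ω (A a) (A b) * c b).re := by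
  rw [matsubaraGram_eq hH β ω A hA c, Complex.re_sum]
  refine Finset.sum_nonneg fun i _ => ?_
  rw [Complex.re_sum]
  refine Finset.sum_nonneg fun j _ => ?_
  set z := (∑ a, star (c a) • ((hH.eigenvectorUnitary : Matrix n n ℂ)ᴴ * A a *
    (hH.eigenvectorUnitary : Matrix n n ℂ))) i j
  have hz : z * star z = (Complex.normSq z : ℂ) := Complex.mul_conj z
  rw [hz, Complex.mul_re, Complex.ofReal_re, Complex.ofReal_im, mul_zero, sub_zero]
  exact mul_nonneg (mwt_re_nonneg hβ _ _ _) (Complex.normSq_nonneg _)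

/-- KMS / trace cyclicity: `Ĉ_{AB}(ω) = Ĉ_{BA}(-ω)`. -/
theorem matsubaraCov_swap {H : Matrix n n ℂ} (hH : H.IsHermitian) (β ω : ℝ)
    (A B : Matrix n n ℂ) :
    matsubaraCov hH β ω A B = matsubaraCov hH β (-ω) B A := by
  sorry

/-- Single observable: `Ĉ_{AA}(ω)` is real and non-negative (the `ω = 0` case is the tree's
`Matrix.IsHermitian.re_duhamel_self_nonneg`). -/
theorem matsubaraCov_self_nonneg {H : Matrix n n ℂ} (hH : H.IsHermitian) {β : ℝ} (hβ : 0 ≤ β)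
    (ω : ℝ) {A : Matrix n n ℂ} (hA : A.IsHermitian) :
    0 ≤ (matsubaraCov hH β ω A A).re ∧ (matsubaraCov hH β ω A A).im = 0 := by
  sorry

end Matsubara

section Schur

variable {m k : Type*} [Fintype m] [DecidableEq m] [Fintype k] [DecidableEq k]

omit [DecidableEq k] in
/-- **SCHUR SPLIT (real algebra).** For a real positive definite `P` (temporal/density block),
any real `Q` (spatial/current block) and any real coupling `C` (the `T`-odd mixed block after the
factors of `i` have been absorbed), the quadratic phase form
`a·P a + 2 a·C b - b·Q b` equals the pure damping form in the shifted variable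
`ã = a + P⁻¹ C b` minus the form of `Q' = Q + Cᵀ P⁻¹ C`:
nothing is complex, and the only non-damping piece is a quadratic form in the spatial gradients
alone. -/
theorem schurSplit_quadratic (P : Matrix m m ℝ) (hP : P.PosDef) (Q : Matrix k k ℝ)
    (C : Matrix m k ℝ) (a : m → ℝ) (b : k → ℝ) :
    a ⬝ᵥ P *ᵥ a + 2 * (a ⬝ᵥ C *ᵥ b) - b ⬝ᵥ Q *ᵥ b =
      (a + P⁻¹ *ᵥ (C *ᵥ b)) ⬝ᵥ P *ᵥ (a + P⁻¹ *ᵥ (C *ᵥ b)) -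
        b ⬝ᵥ (Q + Cᵀ * P⁻¹ * C) *ᵥ b := by
  have hdet : IsUnit P.det := (Matrix.isUnit_iff_isUnit_det P).mp hP.isUnit
  set u := P⁻¹ *ᵥ (C *ᵥ b) with hu
  have hPu : P *ᵥ u = C *ᵥ b := by
    rw [hu, Matrix.mulVec_mulVec, Matrix.mul_nonsing_inv _ hdet, Matrix.one_mulVec]
  have hPT : Pᵀ = P := by
    have h := hP.isHermitian
    rw [Matrix.IsHermitian, Matrix.conjTranspose_eq_transpose_of_trivial] at h
    exact h
  have h1 : a ⬝ᵥ P *ᵥ u = a ⬝ᵥ C *ᵥ b := by rw [hPu]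
  have h2 : u ⬝ᵥ P *ᵥ a = a ⬝ᵥ C *ᵥ b := by
    rw [Matrix.dotProduct_mulVec, ← Matrix.mulVec_transpose, hPT, hPu, dotProduct_comm]
  have h3 : u ⬝ᵥ P *ᵥ u = u ⬝ᵥ C *ᵥ b := by rw [hPu]
  have h4 : b ⬝ᵥ (Q + Cᵀ * P⁻¹ * C) *ᵥ b = b ⬝ᵥ Q *ᵥ b + u ⬝ᵥ C *ᵥ b := by
    rw [Matrix.add_mulVec, dotProduct_add]
    congr 1
    have : (Cᵀ * P⁻¹ * C) *ᵥ b = Cᵀ *ᵥ u := by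
      rw [hu, Matrix.mulVec_mulVec, Matrix.mulVec_mulVec, Matrix.mul_assoc]
    rw [this, Matrix.dotProduct_mulVec, ← Matrix.mulVec_transpose, Matrix.transpose_transpose,
      dotProduct_comm]
  rw [h4]
  simp only [Matrix.mulVec_add, dotProduct_add, add_dotProduct]
  rw [h1, h2, h3]
  ring

omit [DecidableEq k] in
/-- If the spatial block is positive semidefinite then so is the unloaded form
`Q' = Q + Cᵀ P⁻¹ C` (it dominates `Q`), hence `exp(+½ b·Q' b) = 𝔼 exp(φ·b)` for a REAL centred
Gaussian `φ` of covariance `Q'` — the annealed real bond twist of the card. -/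
theorem posSemidef_schurShiftForm (P : Matrix m m ℝ) (hP : P.PosDef) (Q : Matrix k k ℝ)
    (hQ : Q.PosSemidef) (C : Matrix m k ℝ) : (Q + Cᵀ * P⁻¹ * C).PosSemidef := by
  have h1 : (Cᴴ * P⁻¹ * C).PosSemidef := hP.posSemidef.inv.conjTranspose_mul_mul_same C
  rw [Matrix.conjTranspose_eq_transpose_of_trivial] at h1
  exact hQ.add h1

/-- Gaussian unloading in one variable (Mathlib's `ProbabilityTheory.mgf_gaussianReal`):
`𝔼_{φ ∼ N(0,v)} e^{t φ} = e^{v t²/2}`; the multivariate case diagonalises `Q'`. -/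
example (v : NNReal) :
    ProbabilityTheory.mgf id (ProbabilityTheory.gaussianReal 0 v)
      = fun t => Real.exp (0 * t + v * t ^ 2 / 2) :=
  ProbabilityTheory.mgf_id_gaussianReal (μ := 0) (v := v)

end Schur

/-! ## Card `holder-static-visons` -/

section Coercivity

open Literature.Probability.LatticeModels
open scoped Classical

/-- Principal-value bond difference in `(-π, π]`. -/
def wrapAngle (t : ℝ) : ℝ := toIocMod Real.two_pi_pos (-Real.pi) t

/-- Winding number (times `2π`) of a site phase field around the plaquette with lower-left
corner `x` on the torus `(ℤ/L)²`. -/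
def plaquetteWinding {L : ℕ} [NeZero L] (θ : TorusSite 2 L → ℝ) (x : TorusSite 2 L) : ℝ :=
  wrapAngle (θ (x + ![1, 0]) - θ x) + wrapAngle (θ (x + ![1, 1]) - θ (x + ![1, 0])) +
    wrapAngle (θ (x + ![0, 1]) - θ (x + ![1, 1])) + wrapAngle (θ x - θ (x + ![0, 1]))

/-- Number of plaquettes carrying a vortex (non-zero winding). -/
def vortexCount {L : ℕ} [NeZero L] (θ : TorusSite 2 L → ℝ) : ℕ :=
  (Finset.univ.filter fun x : TorusSite 2 L => plaquetteWinding θ x ≠ 0).card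

/-- **Typed static input of `holder-static-visons`: nodal texture coercivity MODULO VORTICES.**
The `Δ₂ = 0` (pure `d_{x²-y²}`, four Dirac nodes) analogue of `BalabanIR.BirBdGPhaseCoercivity`
with a vortex allowance: on `(ℤ/L)²`, `h = -(adjacency) - μ`, bond pair field
`D(θ)_{xy} = Δ₀ g_{x²-y²}(y-x) (e^{iθ_x} + e^{iθ_y})/2`, `Hb(θ) = [[h, D(θ)],[D(θ)ᴴ, -h]]`,
CLAIM: `∀ μ ∈ (-4,4)∖{0} ∀ Δ₀ > 0 ∃ c₀ > 0 ∃ C ≥ 0 ∃ L₀ ∀ L ≥ L₀ ∀ θ: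
  Σ|λ(Hb 0)| - Σ|λ(Hb θ)| ≥ c₀ Σ_{⟨xy⟩}(1 - cos(θ_x - θ_y)) - C · #vortices(θ)`.
The vortex allowance `C` is where the premise `VisonPairCost` (bounded Z₂-flux pair cost,
uniformly in separation and side) enters: it keeps the singular (vison) part of a vortex pair's
quasiparticle energy from growing with the separation, so only cores are paid for. -/
def NodalTextureCoercivityModVortices : Prop :=
  ∀ (μ Δ₀ : ℝ), μ ∈ Set.Ioo (-4:ℝ) 4 → μ ≠ 0 → 0 < Δ₀ → ∃ c₀ : ℝ, 0 < c₀ ∧ ∃ C : ℝ, 0 ≤ C ∧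
    ∃ L₀ : ℕ, ∀ (L : ℕ) [NeZero L], L₀ ≤ L →
    let nnx : TorusSite 2 L → TorusSite 2 L → Prop := fun x y => y = x + ![1, 0] ∨ y = x + ![-1, 0]
    let nny : TorusSite 2 L → TorusSite 2 L → Prop := fun x y => y = x + ![0, 1] ∨ y = x + ![0, -1]
    let h : Matrix (TorusSite 2 L) (TorusSite 2 L) ℂ :=
      fun x y => -(if nnx x y ∨ nny x y then (1 : ℂ) else 0) - (if x = y then (μ : ℂ) else 0)
    let D : (TorusSite 2 L → ℝ) → Matrix (TorusSite 2 L) (TorusSite 2 L) ℂ := fun θ x y =>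
      (Δ₀ : ℂ) * ((if nnx x y then (1 : ℂ) else 0) - (if nny x y then (1 : ℂ) else 0)) *
        (Complex.exp (Complex.I * (θ x : ℂ)) + Complex.exp (Complex.I * (θ y : ℂ))) / 2
    let Hb : (TorusSite 2 L → ℝ) →
        Matrix (TorusSite 2 L ⊕ TorusSite 2 L) (TorusSite 2 L ⊕ TorusSite 2 L) ℂ :=
      fun θ => Matrix.fromBlocks h (D θ) (Matrix.conjTranspose (D θ)) (-h)
    ∀ θ : TorusSite 2 L → ℝ, ∀ (hθ : (Hb θ).IsHermitian) (h0 : (Hb (fun _ => 0)).IsHermitian),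
      c₀ * ∑ x : TorusSite 2 L, ∑ y : TorusSite 2 L,
          (if nnx x y ∨ nny x y then (1 - Real.cos (θ x - θ y)) else 0) - C * (vortexCount θ : ℝ)
        ≤ ∑ i, |h0.eigenvalues i| - ∑ i, |hθ.eigenvalues i|

/-- **Composition shape (tree dictionary).** The dyadic trace Hölder dictionary of the tree,
`norm_trace_prod_exp_le_exp_sub_sum`, turns per-slice exponent bounds `b_i ≤ b₀ - κ R_i` into the
modulus bound `‖Tr ∏ e^{G_i}‖ ≤ e^{M b₀} e^{-κ Σ R_i}`; with `R_i := XY(θ_i) - (C/c₀)·#vortices(θ_i)`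
and `κ = a c₀/2` (quasi-free slice free energy `= (a/2)Σ|λ(θ_i)| + O(log/M)`) this is the
space-time statement "one small factor per misaligned slice, one bounded factor `e^{aC/2}` per
vortex per slice" — i.e. O(1) per unit vortex-line length, for time-like AND space-like segments
alike, from STATIC data only. -/
example {ν : Type*} [Fintype ν] [DecidableEq ν] (kk : ℕ) (G : Fin (2 ^ (kk + 1)) → Matrix ν ν ℂ)
    (hG : ∀ i, (G i).IsHermitian) (b : Fin (2 ^ (kk + 1)) → ℝ)
    (hb : ∀ i, ((NormedSpace.exp ((2 ^ (kk + 1)) • G i)).trace).re ≤ Real.exp (2 ^ (kk + 1) * b i))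
    (b₀ κ : ℝ) (R : Fin (2 ^ (kk + 1)) → ℝ) (hR : ∀ i, b i ≤ b₀ - κ * R i) :
    ‖(List.ofFn fun i => NormedSpace.exp (G i)).prod.trace‖ ≤
      Real.exp (2 ^ (kk + 1) * b₀) * Real.exp (-(κ * ∑ i, R i)) :=
  Summit.HubbardSuperconductivity.HubbardSuperconductivity.Theorems.norm_trace_prod_exp_le_exp_sub_sum
    kk G hG b hb b₀ κ R hR

end Coercivity

end Summit.HubbardSuperconductivity.HubbardSuperconductivity.Cruxes.NodalReduction.SketchIdeator1
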